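/- Copyright: the b2b-balaban cell (near-miss cell 7), T⁴-continuum fan-out; row NE7b ROUND-2 swarm, seat
t4-ne7b-formalise-leaf-02 (gen 10) (road W-RP, sub-row «W6-opt (b)»: node test (t5) of row W6's witness shape
`ChessboardRoadWitness`; leaf-03 g4 «GO on W6-opt (b)» journal l.16954).  Released under the licence of the surrounding
project. -/
import Summits.QuantumFields.BalabanUV.T4Continuum.Support.HistoryChessboardApex
import Summits.QuantumFields.BalabanUV.T4Continuum.Support.HistoryChessboardEndWitness
import Summits.QuantumFields.BalabanUV.T4Continuum.Support.HistoryRealiseCellsRunApexWitnessData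

/-!
# Road W-RP, row W6: THE CHESSBOARD-ROAD WITNESS SHAPE IS INHABITED — on EVERY finite-ε datum (node test (t5))

Summits-side support leaf of the T⁴-continuum cell (rung (B)+1 on a FINITE torus only; NOT infinite volume, NOT the
mass gap, NOT the Clay statement; NOT a proof of the spine estimate NE7b).  Row NE7b, road **W-RP**, sub-row «W6-opt (b)»
of the claim table `t4/b2b-balaban-t4-ne7b-p1/LEAVES-NE7b.md` (row W6 «W-ROAD APEX ∕ HEADLINE», leaf-03 g4: files
`HistoryChessboardPinned` p225499, `HistoryChessboardApex` p225502; optional toy := this seat, owner bookings v3.51∕v3.52).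
A NON-VACUITY NODE TEST of the hypothesis shape `HistoryChessboardApex.ChessboardRoadWitness` — the one displayed datum of the
apex theorems `hybridNE7Under_of_chessboardRoad(_fsc)`.  The count road's analogue is row S12h
(`HistoryRealiseCellsRunApexWitness{,Data}`, p220350): there the witness `CountRoadWitness` is inhabited on the χ := 1 toy
datum and EMPTY on the tree's placeholder `T4FiniteEpsInhabited.stubData` (its (γ)-floor field).  HERE THE OUTCOME DIFFERS,
and the difference is the located content of this file: the chessboard-road witness has NO floor field — (B)'s global lower
bound enters road W only through the DISPLAYED ratio clause `univ_le` ((U1)+(G2)) of `CutoffReading` — so the shape is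
inhabited on **EVERY** `D : FiniteEpsData F G`, for every run `g₀` and every loop string whose product observable is
identically `1` (every string over a subsingleton gauge group, e.g. `SU(1)`; the EMPTY string over any regular group),
the placeholder `stubData` included.

WHAT IS BUILT [decided toy on OUR carriers; nothing of Bałaban's is modelled; by-name over `HistoryChessboardEndWitness`
(p225144: `cutoffReading_unit`, `shellWeightBound_zero`), `T4StabilitySocket.exists_const_dressedZ`, S12h's
`prodObs_nil`∕`prodObs_eq_one`∕`subsingleton_SU1`].
* §1 `ZOf D g₀ os K t := ∫ e^{t·prodObs} ρ₀ dU` — the datum's OWN dressed integral of run `K` (Bałaban's normalisation,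
  the left member of the witness' E1∕E2 identities); `ZOf_zero_pos` (`= c·partitionFn > 0`, ANY datum, no measurability
  needed at `t = 0`); under `hobs : prodObs ≡ 1`: `ZOf_eq_exp_mul` (`ZOf K t = e^t·ZOf K 0`), `ZOf_pos`, the two-run
  log-ratio `nuOf` with `exp_nuOf_mul` (the NE7 sandwich as an IDENTITY).
* §2 **`witnessOf D hobs : ChessboardRoadWitness D g₀ os Unit Unit (fun _ => Unit) (fun _ => Unit) 1 2`** — ONE term per
  cutoff, `A K t () := ZOf D g₀ os K t`, `A′ K t () := ZOf D g₀ os (K+1) t` (`reprA`∕`reprB` by `sum_singleton`), per-cutoff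
  readings = `cutoffReading_unit` at `z := ZOf … K 0` (carrier `Unit`, Dirac state, source `obs ≡ 1`, EMPTY cell events ⇒
  rates `0`), shells `0` (`shellWeightBound_zero`), the NE7 budget WITH EQUALITY (`Cc K t () := ν K := nuOf … K`, radii and
  recent constants `0`, rates `0`), `l₀ = vol = 1`, `K₀ = 0`, `Even 2`.  `nonempty_chessboardRoadWitness_of_prodObs`;
  `nonempty_chessboardRoadWitness_nil` (EMPTY string, ANY datum, ANY regular group, ANY run).
* §3 over a SUBSINGLETON gauge group (every string): `nonempty_chessboardRoadWitness`; the apex hypotheses VERBATIM —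
  **`hData_chessboardRoad`** (the every-run form of `hybridNE7Under_of_chessboardRoad`) and
  **`forSmallCouplings_chessboardRoadWitness`** (the `_fsc` form) — for EVERY datum; hence the apex lineage's PIN-FREE step
  FIRES: **`forSmallCouplings_stringwise`** (`ForSmallCouplings D (StringwiseHybridNE7 ∘ D.scheme)`, non-vacuously) and
  `hybridNE7Under_of_subsingleton` (`HybridNE7Under D (BetaPertHyp D.βfun)`); `…_SU1` instances.
* §4 THE LOCATED DIFFERENCE, decided: on the placeholder `stubData` the chessboard-road witness is INHABITED
  (`nonempty_chessboardRoadWitness_stubData_nil`) while the count-road witness is EMPTY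
  (`HistoryRealiseCellsRunApexWitness.isEmpty_countRoadWitness_stubData`, restated side by side as an `example`); on the χ := 1
  toy datum both are inhabited, and (B) FAILS there (`not_endStatementBPrinted_toy`) — so row W6's file-3 headline, which
  takes (B) as an antecedent, is NOT exercised by any toy, exactly as for the count road.

HONEST.  A node test of a hypothesis SHAPE: one term, no bad term, empty cell events, identity reflections make every
(EXT)∕(LOC)∕(R-sym)∕(RP-ext)∕(U1)+(G2) clause and the NE7c∕NE7 fields trivial BY DESIGN (for a non-trivial string on a
non-trivial group the source-uniform two-run budget IS NE7, available on no toy); discharges NOTHING of the nine spine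
estimates; no exit ∕ socket ∕ `HistoryConstants` file touched (c3); no `def … : Prop` (c1), no `[cite:]`, nothing printed
asserted.  NE7b NOT proved; spine 0∕9.  HONEST DEPENDENCY (cell): continuum YM on T⁴ ⇐ BetaPertH ∧ nine spine estimates
(0/9 proved); BetaPertH ⇐ (D1) ∧ (D4) ∧ CAP+tail; G-an2-4 gates asym, D1 and NE2/3/4.  This file changes none of it.
-/

open Finset MeasureTheory
open Literature.MathematicalPhysics.QuantumFieldTheory.Balaban1983to89
open Literature.MathematicalPhysics.QuantumFieldTheory.Balaban1983to89.T4FiniteEpsInhabited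
open Missing T4Continuum T4StabilitySocket T4MatchingClosure T4IndicatorShell
open Summit.QuantumFields.BalabanUV.T4Continuum.HistoryConstants (PrintedO1s)
open Summit.QuantumFields.BalabanUV.T4Continuum.HistoryChessboardEndWitness
open Summit.QuantumFields.BalabanUV.T4Continuum.HistoryChessboardApex
open Summit.QuantumFields.BalabanUV.T4Continuum.HistoryRealiseCellsRunApexWitness
open Summit.QuantumFields.BalabanUV.T4Continuum.HistoryRealiseCellsRunApexWitnessData

namespace Summit.QuantumFields.BalabanUV.T4Continuum.HistoryChessboardApexWitness

noncomputable section

/-! ## §1 The datum's dressed integrals for a string with trivial product observable -/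

section Dressed

variable {F : T4Family} {G : Type} [GaugeGroup G] [MeasurableSpace G] [HaarData G]

/-- the dressed integral of run `K` at source `t` of the datum `D`, run `g₀`, string `os`, in Bałaban's normalisation —
the left member of the witness' E1∕E2 identities (bookkeeping abbreviation of an integral of the datum's OWN objects) -/
def ZOf (D : FiniteEpsData F G) (g₀ : ℕ → ℝ) (os : List (ULoop F)) (K : ℕ) (t : ℝ) : ℝ :=
  ∫ U, Real.exp (t * T4GenFunBounds.prodObs (D.scheme g₀) K os U) * D.dens K (g₀ K) 0 U ∂fieldMeasure (F.P K) 0 G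

variable (D : FiniteEpsData F G) (g₀ : ℕ → ℝ) (os : List (ULoop F))

/-- source factorisation WHEN the string's product observable is identically `1`: `ZOf K t = e^t · ZOf K 0` [folklore] -/
theorem ZOf_eq_exp_mul {D : FiniteEpsData F G} {g₀ : ℕ → ℝ} {os : List (ULoop F)}
    (hobs : ∀ (K : ℕ) (U : GaugeField (F.P K) 0 G), T4GenFunBounds.prodObs (D.scheme g₀) K os U = 1)
    (K : ℕ) (t : ℝ) : ZOf D g₀ os K t = Real.exp t * ZOf D g₀ os K 0 := by
  simp only [ZOf, hobs, mul_one, Real.exp_zero, one_mul]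
  exact integral_const_mul _ _

variable [RegularGaugeGroup G]

/-- **AT SOURCE `0` THE DRESSED INTEGRAL OF ANY DATUM IS POSITIVE**: `∫ ρ₀ = c · Z_Wilson` with the run's constant `c > 0`
(`T4StabilitySocket.exists_const_dressedZ`, `T4GenFunBounds.dressedZ_zero`, `partitionFn_pos'`) — for EVERY string (no
measurability is needed at `t = 0`). [folklore] -/
theorem ZOf_zero_pos (K : ℕ) : 0 < ZOf D g₀ os K 0 := by
  obtain ⟨c, hc, -, h⟩ := exists_const_dressedZ D K (g₀ K)
  unfold ZOf
  rw [h, T4GenFunBounds.dressedZ_zero]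
  exact mul_pos hc (partitionFn_pos' (F.P K) (sq_nonneg _))

variable {D g₀ os}

/-- positivity at every source under `prodObs ≡ 1` [folklore] -/
theorem ZOf_pos (hobs : ∀ (K : ℕ) (U : GaugeField (F.P K) 0 G), T4GenFunBounds.prodObs (D.scheme g₀) K os U = 1)
    (K : ℕ) (t : ℝ) : 0 < ZOf D g₀ os K t := by
  rw [ZOf_eq_exp_mul hobs]
  exact mul_pos (Real.exp_pos t) (ZOf_zero_pos D g₀ os K)

variable (D g₀ os) in
/-- the two-run log-ratio `log (ZOf (K+1) 0 ∕ ZOf K 0)` (bookkeeping abbreviation) -/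
def nuOf (K : ℕ) : ℝ := Real.log (ZOf D g₀ os (K + 1) 0 / ZOf D g₀ os K 0)

/-- **THE NE7 SANDWICH IS AN IDENTITY** under `prodObs ≡ 1`: `e^{nuOf K} · ZOf K t = ZOf (K+1) t`. [folklore] -/
theorem exp_nuOf_mul (hobs : ∀ (K : ℕ) (U : GaugeField (F.P K) 0 G), T4GenFunBounds.prodObs (D.scheme g₀) K os U = 1)
    (K : ℕ) (t : ℝ) : Real.exp (nuOf D g₀ os K) * ZOf D g₀ os K t = ZOf D g₀ os (K + 1) t := by
  have h0 := ZOf_zero_pos D g₀ os K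
  have h1 := ZOf_zero_pos D g₀ os (K + 1)
  rw [nuOf, Real.exp_log (div_pos h1 h0), ZOf_eq_exp_mul hobs K t, ZOf_eq_exp_mul hobs (K + 1) t]
  field_simp

end Dressed

/-! ## §2 The witness: one term per cutoff on the carrier `Unit`, for ANY datum -/

section Witness

variable {F : T4Family} {G : Type} [GaugeGroup G] [MeasurableSpace G] [HaarData G] [RegularGaugeGroup G]

/-- **THE CHESSBOARD-ROAD WITNESS TERM** (module docstring §2) on ANY datum `D`, for any run `g₀` and any string `os`
whose product observable is identically `1`: one term per cutoff with the dressed integrals as weights, per-cutoff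
readings `cutoffReading_unit` (rates `0`), zero shells, the NE7 budget with equality, zero rates. [decided toy] -/
def witnessOf (D : FiniteEpsData F G) {g₀ : ℕ → ℝ} {os : List (ULoop F)}
    (hobs : ∀ (K : ℕ) (U : GaugeField (F.P K) 0 G), T4GenFunBounds.prodObs (D.scheme g₀) K os U = 1) :
    ChessboardRoadWitness D g₀ os Unit Unit (fun _ => Unit) (fun _ => Unit) 1 2 where
  l₀ := 1
  vol := 1
  l₀_pos := one_pos
  vol_pos := one_pos
  K₀ := 0
  even := by decide
  P := {()}
  T := fun _ => {()}
  A := fun K t _ => ZOf D g₀ os K t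
  A' := fun K t _ => ZOf D g₀ os (K + 1) t
  shA := fun _ _ _ => 0
  shB := fun _ _ _ => 0
  Bad := fun _ => ∅
  μ := fun _ => Measure.dirac ()
  Z := fun K => ZOf D g₀ os K 0
  ev := fun _ _ => Set.univ
  obs := fun _ _ => 1
  ob := 1
  E := fun _ _ _ => ∅
  θ := fun _ _ _ => id
  mP := fun _ _ _ => ⊥
  r := fun _ => 0
  μ' := fun _ => Measure.dirac ()
  Z' := fun K => ZOf D g₀ os (K + 1) 0
  ev' := fun _ _ => Set.univ
  obs' := fun _ _ => 1
  E' := fun _ _ _ => ∅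
  θ' := fun _ _ _ => id
  mP' := fun _ _ _ => ⊥
  r' := fun _ => 0
  readingA := fun K _ => cutoffReading_unit (ZOf_zero_pos D g₀ os K) (ZOf_eq_exp_mul hobs K)
  readingB := fun K _ => cutoffReading_unit (ZOf_zero_pos D g₀ os (K + 1)) (ZOf_eq_exp_mul hobs (K + 1))
  sum_r := summable_zero
  sum_r' := summable_zero
  Cc := fun K _ _ => nuOf D g₀ os K
  Rr := fun _ _ _ => 0
  CcRec := fun _ _ _ => 0
  RrRec := fun _ _ _ => 0
  ν := nuOf D g₀ os
  u := fun _ => 0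
  s₂ := fun _ => 0
  c₀ := fun _ => 0
  rr := fun _ => 0
  s := fun _ => 0
  Wsh := fun _ => 0
  shell := shellWeightBound_zero (fun K t _ => (ZOf_pos hobs K t).le) (fun K t _ => (ZOf_pos hobs (K + 1) t).le)
  budget :=
    { nonneg := fun K t _ _ _ => by simpa only [sub_zero] using (ZOf_pos hobs K t).le
      lower := fun K t _ _ _ => by simpa only [sub_zero] using (exp_nuOf_mul hobs K t).le
      upper := fun K t _ _ _ => by simpa only [sub_zero, add_zero] using (exp_nuOf_mul hobs K t).ge
      uv_const := fun _ _ _ _ _ => by simp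
      uv_radius := fun _ _ _ _ _ => by simp
      recent_remainder := fun _ _ _ _ _ => by simp
      recent_deviation := fun _ _ _ _ _ => by simp }
  sum_rr := summable_zero
  sum_u := summable_zero
  sum_s := summable_zero
  sum_s₂ := summable_zero
  reprA := fun K t _ _ => by rw [sum_singleton]; rfl
  reprB := fun K t _ _ => by rw [sum_singleton]; rfl

/-- **THE SHAPE IS INHABITED on ANY datum, for any run and any string with trivial product observable.** [decided toy] -/
theorem nonempty_chessboardRoadWitness_of_prodObs (D : FiniteEpsData F G) {g₀ : ℕ → ℝ} {os : List (ULoop F)}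
    (hobs : ∀ (K : ℕ) (U : GaugeField (F.P K) 0 G), T4GenFunBounds.prodObs (D.scheme g₀) K os U = 1) :
    Nonempty (ChessboardRoadWitness D g₀ os Unit Unit (fun _ => Unit) (fun _ => Unit) 1 2) :=
  ⟨witnessOf D hobs⟩

/-- **… IN PARTICULAR FOR THE EMPTY STRING: ANY datum, ANY regular gauge group, ANY run** (S12h's `prodObs_nil`).
[decided toy] -/
theorem nonempty_chessboardRoadWitness_nil (D : FiniteEpsData F G) (g₀ : ℕ → ℝ) :
    Nonempty (ChessboardRoadWitness D g₀ ([] : List (ULoop F)) Unit Unit (fun _ => Unit) (fun _ => Unit) 1 2) :=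
  nonempty_chessboardRoadWitness_of_prodObs D fun K U => prodObs_nil G (D.scheme g₀) K U

end Witness

/-! ## §3 Over a subsingleton gauge group: every string; the apex hypotheses verbatim; the pin-free step fires -/

section Subsingleton

variable {F : T4Family} {G : Type} [GaugeGroup G] [MeasurableSpace G] [HaarData G] [RegularGaugeGroup G]
  [Subsingleton G]

/-- over a subsingleton gauge group the shape is inhabited for EVERY datum, run and string (`prodObs_eq_one`).
[decided toy] -/
theorem nonempty_chessboardRoadWitness (D : FiniteEpsData F G) (g₀ : ℕ → ℝ) (os : List (ULoop F)) :
    Nonempty (ChessboardRoadWitness D g₀ os Unit Unit (fun _ => Unit) (fun _ => Unit) 1 2) :=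
  nonempty_chessboardRoadWitness_of_prodObs D fun K U => prodObs_eq_one D g₀ K os U

/-- **THE EVERY-RUN HYPOTHESIS `hData` OF `hybridNE7Under_of_chessboardRoad` HOLDS, VERBATIM, for EVERY datum over a
subsingleton gauge group** (the tuning clause is not even used). [decided toy] -/
theorem hData_chessboardRoad (D : FiniteEpsData F G) :
    ∀ (γ g : ℝ) (g₀ : ℕ → ℝ), 0 < γ → 0 < g → D.Tuned γ g g₀ → ∀ os : List (ULoop F),
      ∃ (ι Λ : Type) (_ : DecidableEq ι) (Ω Ω' : ℕ → Type) (_ : ∀ K, MeasurableSpace (Ω K))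
        (_ : ∀ K, MeasurableSpace (Ω' K)) (d N : ℕ) (_ : NeZero N),
        Nonempty (ChessboardRoadWitness D g₀ os ι Λ Ω Ω' d N) :=
  fun _ _ g₀ _ _ _ os => ⟨Unit, Unit, inferInstance, fun _ => Unit, fun _ => Unit, inferInstance, inferInstance, 1, 2,
    inferInstance, nonempty_chessboardRoadWitness D g₀ os⟩

/-- **THE PREFIXED HYPOTHESIS `hData` OF `hybridNE7Under_of_chessboardRoad_fsc` HOLDS, VERBATIM, for EVERY datum over a
subsingleton gauge group** (`ForSmallCouplings.of_forall`: thresholds `γ₀ = g₁ = 1`). [decided toy] -/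
theorem forSmallCouplings_chessboardRoadWitness (D : FiniteEpsData F G) :
    T4ContinuumYM4Torus.ForSmallCouplings D fun g₀ => ∀ os : List (ULoop F),
      ∃ (ι Λ : Type) (_ : DecidableEq ι) (Ω Ω' : ℕ → Type) (_ : ∀ K, MeasurableSpace (Ω K))
        (_ : ∀ K, MeasurableSpace (Ω' K)) (d N : ℕ) (_ : NeZero N),
        Nonempty (ChessboardRoadWitness D g₀ os ι Λ Ω Ω' d N) :=
  T4ContinuumYM4Torus.ForSmallCouplings.of_forall fun g₀ os =>
    ⟨Unit, Unit, inferInstance, fun _ => Unit, fun _ => Unit, inferInstance, inferInstance, 1, 2, inferInstance,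
      nonempty_chessboardRoadWitness D g₀ os⟩

/-- **THE APEX LINEAGE'S PIN-FREE STEP FIRES** (row W6 file 2's `forSmallCouplings_stringwise_of_chessboardRoad` APPLIED):
over a subsingleton gauge group EVERY datum carries, for all small couplings (thresholds `1, 1`), the per-string hybrid-NE7
datum of every loop string — a NON-VACUOUS consequence (no (B), no `BetaPertHyp`). [decided toy] -/
theorem forSmallCouplings_stringwise (D : FiniteEpsData F G) :
    T4ContinuumYM4Torus.ForSmallCouplings D fun g₀ => T4ApexHybrid.StringwiseHybridNE7 (D.scheme g₀) :=
  forSmallCouplings_stringwise_of_chessboardRoad D (forSmallCouplings_chessboardRoadWitness D)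

/-- **ROW W6's APEX THEOREM FIRES**: `HybridNE7Under D (BetaPertHyp D.βfun)` for EVERY datum over a subsingleton gauge group
(`hybridNE7Under_of_chessboardRoad_fsc` APPLIED; its (B)∕`BetaPertHyp` antecedents are accepted-not-used upstream).
[decided toy] -/
theorem hybridNE7Under_of_subsingleton (D : FiniteEpsData F G) :
    T4ApexHybrid.HybridNE7Under D (BetaPertHyp D.βfun) :=
  hybridNE7Under_of_chessboardRoad_fsc D (forSmallCouplings_chessboardRoadWitness D)

end Subsingleton

/-! ### … in particular at `SU(1)` -/

section SU1

variable {F : T4Family}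

/-- at `SU(1)`, for EVERY finite-ε datum: the prefixed witness hypothesis of `hybridNE7Under_of_chessboardRoad_fsc`.
[decided toy] -/
theorem forSmallCouplings_chessboardRoadWitness_SU1 (D : FiniteEpsData F (Matrix.specialUnitaryGroup (Fin 1) ℂ)) :
    T4ContinuumYM4Torus.ForSmallCouplings D fun g₀ => ∀ os : List (ULoop F),
      ∃ (ι Λ : Type) (_ : DecidableEq ι) (Ω Ω' : ℕ → Type) (_ : ∀ K, MeasurableSpace (Ω K))
        (_ : ∀ K, MeasurableSpace (Ω' K)) (d N : ℕ) (_ : NeZero N),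
        Nonempty (ChessboardRoadWitness D g₀ os ι Λ Ω Ω' d N) :=
  haveI := subsingleton_SU1
  forSmallCouplings_chessboardRoadWitness D

/-- at `SU(1)`, for EVERY finite-ε datum: the apex input `HybridNE7Under D (BetaPertHyp D.βfun)`. [decided toy] -/
theorem hybridNE7Under_SU1 (D : FiniteEpsData F (Matrix.specialUnitaryGroup (Fin 1) ℂ)) :
    T4ApexHybrid.HybridNE7Under D (BetaPertHyp D.βfun) :=
  haveI := subsingleton_SU1
  hybridNE7Under_of_subsingleton D

end SU1

/-! ## §4 The located difference with the count road, decided -/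

section Located

variable (F : T4Family) (G : Type) [GaugeGroup G] [MeasurableSpace G] [HaarData G] [RegularGaugeGroup G]

/-- **ON THE TREE'S PLACEHOLDER `stubData` THE CHESSBOARD-ROAD WITNESS IS INHABITED** (empty string, any run, any
regular group): the shape has NO (γ)-floor field. [decided toy] -/
theorem nonempty_chessboardRoadWitness_stubData_nil (av : (K j : ℕ) → Averaging (F.P K) j G)
    (hmeas : ∀ K j, Measurable (av K j).avg) (hac : ∀ K k, k < K → HaarAC (av K k).avg) (g₀ : ℕ → ℝ) :
    Nonempty (ChessboardRoadWitness (stubData F G av hmeas hac) g₀ ([] : List (ULoop F)) Unit Unit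
      (fun _ => Unit) (fun _ => Unit) 1 2) :=
  nonempty_chessboardRoadWitness_nil _ g₀

/-- … WHEREAS THE COUNT-ROAD WITNESS IS EMPTY THERE (S12h's `isEmpty_countRoadWitness_stubData`, by the (γ) floor
`0 < c₀ ≤ smallFieldMass = 0`) — side by side: the two roads' displayed sets DIFFER in what they can detect of the datum;
road W carries (B)'s lower bound only inside the displayed ratio clause `univ_le`. [decided toy] -/
example (av : (K j : ℕ) → Averaging (F.P K) j G) (hmeas : ∀ K j, Measurable (av K j).avg)
    (hac : ∀ K k, k < K → HaarAC (av K k).avg) (C : T4PrintedShapeBanking.Consts) (O : PrintedO1s) (rr d n : ℕ)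
    (g₀ : ℕ → ℝ) :
    IsEmpty (HistoryRealiseCellsRunApex.CountRoadWitness (stubData F G av hmeas hac) C O rr d n g₀
        ([] : List (ULoop F)) Unit Empty Unit) ∧
      Nonempty (ChessboardRoadWitness (stubData F G av hmeas hac) g₀ ([] : List (ULoop F)) Unit Unit
        (fun _ => Unit) (fun _ => Unit) 1 2) :=
  ⟨isEmpty_countRoadWitness_stubData F G av hmeas hac C O rr d n g₀ [] Unit Empty Unit,
    nonempty_chessboardRoadWitness_stubData_nil F G av hmeas hac g₀⟩

/-- On the χ := 1 toy datum of S12h both roads' witnesses are inhabited (empty string, tuned run `g₀ ≡ 1`), and (B) FAILS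
there (`not_endStatementBPrinted_toy`) — so row W6's file-3 headline, which takes (B) as an antecedent, is exercised by
NO toy, exactly as the count road's. [decided toy] -/
example (C : T4PrintedShapeBanking.Consts) (O : PrintedO1s) (rr d n : ℕ) :
    Nonempty (HistoryRealiseCellsRunApex.CountRoadWitness (toyData F G) C O rr d n gOne ([] : List (ULoop F))
        Unit Empty Unit) ∧
      Nonempty (ChessboardRoadWitness (toyData F G) gOne ([] : List (ULoop F)) Unit Unit (fun _ => Unit)
        (fun _ => Unit) 1 2) ∧
      ¬ B16.EndStatementBPrinted (toyData F G).C :=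
  ⟨nonempty_countRoadWitness_toy F G C O rr d n, nonempty_chessboardRoadWitness_nil _ gOne,
    not_endStatementBPrinted_toy F G⟩

end Located

end

end Summit.QuantumFields.BalabanUV.T4Continuum.HistoryChessboardApexWitness
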